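import Summits.Ventures.LatticeQCDFlow.Exactness.IMHColdStartWindowMSE
import Summits.Ventures.LatticeQCDFlow.Scoring.ReplicaChains
import HarnessLib

/-!
# The cold start, second order: the explicit error bar of a cold-started flow-MCMC run —
# `E_{x₀}[(A_N − π f)²] ≤ (2w − 1)·Var_π f/N + (2w² − w)·δ²/N²`

HONEST FRAMING: exact (Metropolis-corrected) sampling algorithms for lattice gauge theory;
figures of merit are autocorrelation/cost numbers at stated couplings and volumes; no
continuum-physics claim.

Venture `LatticeQCDFlow` (cell pub-lqcd), topic `Exactness`; FANOUT row 30 (lean-1, GEN-32).  NEW WORK of the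
cell, general state space.  Setting of this generation's files: `K = indepMH q w`, `w` normalised, maximal at `x₀`,
`w = w(x₀) = 1/A(x₀)`, `r = 1 − 1/w`, `f` bounded measurable, `δ = f(x₀) − π f`, `V = Var_π f`, `A_N` the time
average, `A_{b,N}` the window average, `MSE_μ(N) = E_μ[(A_N − π f)²]`.  The Scoring row's any-start certificate for a
Doeblin chain (`Scoring/ChainMeanSquareError`) reads, with flow-MCMC's exact constant `ε = 1/w`,
`MSE ≤ (2w − 1)·V/N + 16(C + |π f|)²·w²/N²`.  Composing this generation's exact second-order law with the Scoring
row's STATIONARY variance bound gives the cold start its own explicit, smaller error bar: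

* §1 **`imh_chain_mse_stationary_le`** — the equilibrium run: `MSE_π(N) ≤ (2w − 1)·V/N` (the Scoring row's
  `variance_timeAverage_le_of_doeblin` with the exact Doeblin constant of `IMHKernel.indepMH_apply_ge`, and
  `E_π A_N = π f`).
* §2 **`imh_chain_mse_mode_le_explicit`** — THE COLD-STARTED RUN:
  `MSE_{x₀}(N) ≤ (2w − 1)·V/N + (2w² − w)·δ²/N²` — first-order term = the equilibrium certificate, second-order term
  `(2w² − w)δ²` in place of `16(C + |π f|)²w²` (`δ² ≤ 4C'²`, so at least `32×` smaller, and exact in its dependence on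
  the observable through `δ` alone); **`imh_chain_windowMSE_mode_le_explicit`** — after discarding `b` steps:
  `E_{x₀}[(A_{b,N} − π f)²] ≤ (2w − 1)·V/N + r^b·(2w² − w)·δ²/N²`.
* §3 **`imh_chain_deviation_mode_le`** — Chebyshev: for `t > 0`,
  `P_{x₀}(|A_N − π f| ≥ t) ≤ [(2w − 1)·V/N + (2w² − w)·δ²/N²]/t²` — a certified confidence statement for a single
  cold-started run in terms of `w = 1/A(x₀)`, `V` and `δ` only.

Reading (value-free; gauge files restate it with `w = c^{#B}M^k/Z` resp. `∏_ℓ c_{#C_ℓ}/Z`): a cold-started exact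
gauge sampler run of length `N` estimates every bounded observable to root-mean-square accuracy
`√((2/A − 1)·Var_π f/N + (2/A² − 1/A)·δf²/N²)`.  NOT CLAIMED: the values of `V`, `δ`, `A` for any specific weight;
sharper-than-Chebyshev tails; non-modal starts (the Scoring certificate covers them with `16C'²w²`).

No `sorry`, no new definitions, nothing cited as a fact; general measurable space with measurable singletons.
-/

noncomputable section

namespace Summit.Ventures.LatticeQCDFlow.Exactness

open MeasureTheory ProbabilityTheory Function Finset
open scoped ENNReal
open Summit.Ventures.LatticeQCDFlow.Scoring

variable {Ω : Type*} [MeasurableSpace Ω] [MeasurableSingletonClass Ω]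
variable {q : Measure Ω} [IsProbabilityMeasure q] {w : Ω → ℝ}

/-! ## §1 The equilibrium run's error bar with the exact Doeblin constant -/

omit [MeasurableSingletonClass Ω] in
/-- **`MSE_π(N) ≤ (2w(x₀) − 1)·Var_π f/N`** for the stationary flow-MCMC chain (`N ≥ 1`): the Scoring row's variance
certificate with the exact constant `ε = 1/w(x₀)`, and `E_π A_N = π f`. [ours, composing the tree] -/
theorem imh_chain_mse_stationary_le [Fact (Measurable w)] (hw0 : ∀ y, 0 < w y) {x₀ : Ω} (hmax : ∀ y, w y ≤ w x₀)
    [IsProbabilityMeasure (q.withDensity fun y => ENNReal.ofReal (w y))]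
    {f : Ω → ℝ} (hf : Measurable f) {C : ℝ} (hC : ∀ x, |f x| ≤ C) {N : ℕ} (hN : N ≠ 0) :
    ∫ x, ((∑ i ∈ Finset.range N, f (x i)) / N - ∫ z, f z ∂(q.withDensity fun y => ENNReal.ofReal (w y))) ^ 2
        ∂(Kernel.trajMeasure (X := fun _ : ℕ => Ω) (q.withDensity fun y => ENNReal.ofReal (w y))
          (fun n : ℕ => (indepMH q w).comap (fun h : (i : ↥(Finset.Iic n)) → Ω => h ⟨n, Finset.mem_Iic.2 le_rfl⟩)
            (measurable_pi_apply _))) ≤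
      (2 * w x₀ - 1) *
        (∫ x, (f x - ∫ z, f z ∂(q.withDensity fun y => ENNReal.ofReal (w y))) ^ 2
          ∂(q.withDensity fun y => ENNReal.ofReal (w y))) / N := by
  set π : Measure Ω := q.withDensity fun y => ENNReal.ofReal (w y) with hπdef
  set P := Kernel.trajMeasure (X := fun _ : ℕ => Ω) π
      (fun n : ℕ => (indepMH q w).comap (fun h : (i : ↥(Finset.Iic n)) → Ω => h ⟨n, Finset.mem_Iic.2 le_rfl⟩)
        (measurable_pi_apply _)) with hP
  have hw : Measurable w := Fact.out
  have hWpos : 0 < w x₀ := hw0 x₀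
  have hπK : Kernel.Invariant (indepMH q w) π := indepMH_invariant (q := q) hw hw0
  have hmin : ∀ x {B : Set Ω}, MeasurableSet B → (ENNReal.ofReal (w x₀))⁻¹ * π B ≤ indepMH q w x B :=
    fun x B hB => indepMH_apply_ge hw hw0 hmax x hB
  have hε0 : 0 < (ENNReal.ofReal (w x₀))⁻¹ := ENNReal.inv_pos.2 ENNReal.ofReal_ne_top
  have hvar := variance_timeAverage_le_of_doeblin (κ := indepMH q w) hπK hmin hε0 hf hC hN
  have htoReal : ((ENNReal.ofReal (w x₀))⁻¹).toReal = (w x₀)⁻¹ := by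
    rw [ENNReal.toReal_inv, ENNReal.toReal_ofReal hWpos.le]
  rw [htoReal] at hvar
  -- the stationary mean of the time average is `π f`, so the MSE about `π f` is the variance
  have hNpos : (0 : ℝ) < N := by exact_mod_cast Nat.pos_of_ne_zero hN
  have hAm : Measurable fun x : ℕ → Ω => (∑ i ∈ Finset.range N, f (x i)) / N :=
    (Finset.measurable_sum _ fun i _ => hf.comp (measurable_pi_apply i)).div_const _
  have hmean : ∫ x, (∑ i ∈ Finset.range N, f (x i)) / N ∂P = ∫ z, f z ∂π := by
    rw [hP]; exact chain_mean_timeAverage hπK hf hC hN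
  have hV : Var[fun x : ℕ → Ω => (∑ i ∈ Finset.range N, f (x i)) / N; P] =
      ∫ x, ((∑ i ∈ Finset.range N, f (x i)) / N - ∫ z, f z ∂π) ^ 2 ∂P := by
    rw [variance_eq_integral hAm.aemeasurable]
    simp only [hmean]
  have hγ0 : autocov (indepMH q w) π (fun y => f y - ∫ z, f z ∂π) 0 = ∫ x, (f x - ∫ z, f z ∂π) ^ 2 ∂π := by
    rw [autocov]
    exact integral_congr_ae (ae_of_all _ fun x => by simp only [Function.iterate_zero, id]; rw [sq])
  rw [hV, hγ0] at hvar
  have h2 : 2 / (w x₀)⁻¹ - 1 = 2 * w x₀ - 1 := by rw [div_inv_eq_mul]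
  rw [h2] at hvar
  exact hvar

/-! ## §2 The explicit error bar of the cold-started run -/

/-- **`MSE_{x₀}(N) ≤ (2w − 1)·V/N + (2w² − w)·δ²/N²`** for the cold-started flow-MCMC time average (`N ≥ 1`,
`w = w(x₀) = 1/A(x₀)`). [ours] -/
theorem imh_chain_mse_mode_le_explicit [Fact (Measurable w)] (hw0 : ∀ y, 0 < w y) {x₀ : Ω}
    (hmax : ∀ y, w y ≤ w x₀) [IsProbabilityMeasure (q.withDensity fun y => ENNReal.ofReal (w y))]
    {f : Ω → ℝ} (hf : Measurable f) {C : ℝ} (hC : ∀ x, |f x| ≤ C) {N : ℕ} (hN : N ≠ 0) :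
    ∫ x, ((∑ i ∈ Finset.range N, f (x i)) / N - ∫ z, f z ∂(q.withDensity fun y => ENNReal.ofReal (w y))) ^ 2
        ∂(Kernel.trajMeasure (X := fun _ : ℕ => Ω) (Measure.dirac x₀)
          (fun n : ℕ => (indepMH q w).comap (fun h : (i : ↥(Finset.Iic n)) → Ω => h ⟨n, Finset.mem_Iic.2 le_rfl⟩)
            (measurable_pi_apply _))) ≤
      (2 * w x₀ - 1) *
          (∫ x, (f x - ∫ z, f z ∂(q.withDensity fun y => ENNReal.ofReal (w y))) ^ 2
            ∂(q.withDensity fun y => ENNReal.ofReal (w y))) / N +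
        (2 * w x₀ ^ 2 - w x₀) * (f x₀ - ∫ z, f z ∂(q.withDensity fun y => ENNReal.ofReal (w y))) ^ 2 /
          (N : ℝ) ^ 2 := by
  have h1 := imh_chain_mse_mode_le_stationary_add (q := q) hw0 hmax hf hC hN (x₀ := x₀)
  have h2 := imh_chain_mse_stationary_le (q := q) hw0 hmax hf hC hN (x₀ := x₀)
  linarith

/-- **After discarding `b` steps: `E_{x₀}[(A_{b,N} − π f)²] ≤ (2w − 1)·V/N + r^b·(2w² − w)·δ²/N²`.** [ours] -/
theorem imh_chain_windowMSE_mode_le_explicit [Fact (Measurable w)] (hw0 : ∀ y, 0 < w y) {x₀ : Ω}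
    (hmax : ∀ y, w y ≤ w x₀) [IsProbabilityMeasure (q.withDensity fun y => ENNReal.ofReal (w y))]
    {f : Ω → ℝ} (hf : Measurable f) {C : ℝ} (hC : ∀ x, |f x| ≤ C) (b : ℕ) {N : ℕ} (hN : N ≠ 0) :
    ∫ x, ((∑ i ∈ Finset.range N, f (x (b + i))) / N -
          ∫ z, f z ∂(q.withDensity fun y => ENNReal.ofReal (w y))) ^ 2
        ∂(Kernel.trajMeasure (X := fun _ : ℕ => Ω) (Measure.dirac x₀)
          (fun n : ℕ => (indepMH q w).comap (fun h : (i : ↥(Finset.Iic n)) → Ω => h ⟨n, Finset.mem_Iic.2 le_rfl⟩)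
            (measurable_pi_apply _))) ≤
      (2 * w x₀ - 1) *
          (∫ x, (f x - ∫ z, f z ∂(q.withDensity fun y => ENNReal.ofReal (w y))) ^ 2
            ∂(q.withDensity fun y => ENNReal.ofReal (w y))) / N +
        (1 - (w x₀)⁻¹) ^ b * (2 * w x₀ ^ 2 - w x₀) *
          (f x₀ - ∫ z, f z ∂(q.withDensity fun y => ENNReal.ofReal (w y))) ^ 2 / (N : ℝ) ^ 2 := by
  have h1 := imh_chain_windowMSE_mode_le (q := q) hw0 hmax hf hC b hN (x₀ := x₀)
  have h2 := imh_chain_mse_stationary_le (q := q) hw0 hmax hf hC hN (x₀ := x₀)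
  linarith

/-! ## §3 A certified confidence statement for one cold-started run -/

omit [MeasurableSingletonClass Ω] [IsProbabilityMeasure q] in
/-- The time average of a bounded observable is square-integrable on path space. [ours, bookkeeping] -/
theorem chain_memLp_timeAverage (κ : Kernel Ω Ω) [IsMarkovKernel κ] (μ₀ : Measure Ω) [IsProbabilityMeasure μ₀]
    {f : Ω → ℝ} (hf : Measurable f) {C : ℝ} (hC : ∀ x, |f x| ≤ C) (N : ℕ) :
    MemLp (fun x : ℕ → Ω => (∑ i ∈ Finset.range N, f (x i)) / N)  2
      (Kernel.trajMeasure (X := fun _ : ℕ => Ω) μ₀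
        (fun n : ℕ => κ.comap (fun h : (i : ↥(Finset.Iic n)) → Ω => h ⟨n, Finset.mem_Iic.2 le_rfl⟩)
          (measurable_pi_apply _))) := by
  rcases Nat.eq_zero_or_pos N with hN | hN
  · subst hN
    simp only [Finset.range_zero, Finset.sum_empty, Nat.cast_zero, div_zero]
    exact memLp_const 0
  have hNpos : (0 : ℝ) < N := by exact_mod_cast hN
  have hAm : Measurable fun x : ℕ → Ω => (∑ i ∈ Finset.range N, f (x i)) / N :=
    (Finset.measurable_sum _ fun i _ => hf.comp (measurable_pi_apply i)).div_const _
  refine MemLp.of_bound hAm.aestronglyMeasurable C (ae_of_all _ fun x => ?_)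
  rw [Real.norm_eq_abs, abs_div, abs_of_pos hNpos, div_le_iff₀ hNpos]
  calc |∑ i ∈ Finset.range N, f (x i)| ≤ ∑ i ∈ Finset.range N, |f (x i)| := abs_sum_le_sum_abs _ _
    _ ≤ ∑ _i ∈ Finset.range N, C := sum_le_sum fun i _ => hC (x i)
    _ = C * N := by rw [sum_const, card_range, nsmul_eq_mul, mul_comm]

/-- **`P_{x₀}(|A_N − π f| ≥ t) ≤ [(2w − 1)·V/N + (2w² − w)·δ²/N²]/t²`** for `t > 0`, `N ≥ 1`: Chebyshev on the explicit
error bar — a certified deviation bound for a single cold-started flow-MCMC run in terms of `w = 1/A(x₀)`,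
`V = Var_π f` and `δ = f(x₀) − π f` only. [ours] -/
theorem imh_chain_deviation_mode_le [Fact (Measurable w)] (hw0 : ∀ y, 0 < w y) {x₀ : Ω}
    (hmax : ∀ y, w y ≤ w x₀) [IsProbabilityMeasure (q.withDensity fun y => ENNReal.ofReal (w y))]
    {f : Ω → ℝ} (hf : Measurable f) {C : ℝ} (hC : ∀ x, |f x| ≤ C) {N : ℕ} (hN : N ≠ 0) {t : ℝ} (ht : 0 < t) :
    (Kernel.trajMeasure (X := fun _ : ℕ => Ω) (Measure.dirac x₀)
          (fun n : ℕ => (indepMH q w).comap (fun h : (i : ↥(Finset.Iic n)) → Ω => h ⟨n, Finset.mem_Iic.2 le_rfl⟩)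
            (measurable_pi_apply _))).real
        {x | t ≤ |(∑ i ∈ Finset.range N, f (x i)) / N - ∫ z, f z ∂(q.withDensity fun y => ENNReal.ofReal (w y))|} ≤
      ((2 * w x₀ - 1) *
            (∫ x, (f x - ∫ z, f z ∂(q.withDensity fun y => ENNReal.ofReal (w y))) ^ 2
              ∂(q.withDensity fun y => ENNReal.ofReal (w y))) / N +
          (2 * w x₀ ^ 2 - w x₀) * (f x₀ - ∫ z, f z ∂(q.withDensity fun y => ENNReal.ofReal (w y))) ^ 2 /
            (N : ℝ) ^ 2) / t ^ 2 := by
  have hcheb := measureReal_abs_sub_ge_le (chain_memLp_timeAverage (indepMH q w) (Measure.dirac x₀) hf hC N)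
    (∫ z, f z ∂(q.withDensity fun y => ENNReal.ofReal (w y))) ht
  refine hcheb.trans (div_le_div_of_nonneg_right ?_ (sq_nonneg t))
  exact imh_chain_mse_mode_le_explicit hw0 hmax hf hC hN

end Summit.Ventures.LatticeQCDFlow.Exactness
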